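import Summits.QuantumFields.YangMills.Theorems.ColdStartUniversalityLatticeLangevinRidgeSpan
import Literature.MathematicalPhysics.QuantumFieldTheory.Balaban1983to89.InfiniteVolumeSufficientXXI
import Summits.QuantumFields.YangMills.Theorems.ColdStartUniversalityLatticeLangevinFeller
import Mathlib.Topology.ContinuousMap.StoneWeierstrass
import HarnessLib

/-!
# Route `ColdStartUniversality`, crux K_A1 `UniformColdStartMixing` (stmt-QuantumFields-24809), rung `stub_fixedCutoffMixing`:
# G-block, brick N5c — latitude eigenfunctions are uniformly dense in `C(SU(2)^E)`

Helper file (seat `ym-line-csu-p1`, g7).  The real subalgebra of `C(SU(2)^E, ℝ)` generated by the quaternion coordinates of the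
links separates points, so it is dense (Stone–Weierstrass); every element of it is in ridge form (brick N5b).  Hence every
continuous function on `SU(2)^E` is within any `ε > 0`, uniformly, of a finite sum of products of latitude eigenfunctions
`∏_e U_{m_e}(⟨ρ g_e, ρ V_e⟩/2)` (`exists_ridge_uniform_near`).  No definition, no sorry.  RECORD-rung R3 plumbing.
-/

set_option autoImplicit false

noncomputable section

namespace Summit.QuantumFields.YangMills.Theorems.ColdStartUniversality

open Finset
open scoped BigOperators
open Literature.MathematicalPhysics.QuantumFieldTheory
open Literature.MathematicalPhysics.QuantumLattice (fundamentalRep)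
open Literature.Analysis.SpecialFunctions (gegenbauerSum)

variable {L : ℕ} [NeZero L]

/-- **Uniform density of ridge form in `C(SU(2)^E)`** (Stone–Weierstrass for the coordinate algebra + brick N5b). [folklore] -/
theorem exists_ridge_uniform_near {G : GaugeConfig 3 L (Matrix.specialUnitaryGroup (Fin 2) ℂ) → ℝ} (hG : Continuous G)
    {ε : ℝ} (hε : 0 < ε) :
    ∃ (κ : Type) (_ : Fintype κ) (c : κ → ℝ) (g : κ → Edge 3 L → Matrix.specialUnitaryGroup (Fin 2) ℂ)
      (m : κ → Edge 3 L → ℕ), ∀ V : GaugeConfig 3 L (Matrix.specialUnitaryGroup (Fin 2) ℂ),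
      |(∑ l, c l * ∏ e, gegenbauerSum 1 (m l e)
          (hsForm 2 (fundamentalRep (Fin 2) (g l e)) (fundamentalRep (Fin 2) (V e)) / 2)) - G V| < ε := by
  classical
  -- the four coordinate observables of each link, as continuous maps
  have hcont : ∀ (e : Edge 3 L) (j : Fin 4), Continuous fun V : GaugeConfig 3 L (Matrix.specialUnitaryGroup (Fin 2) ℂ) =>
      (![((V e : Matrix (Fin 2) (Fin 2) ℂ) 0 0).re, ((V e : Matrix (Fin 2) (Fin 2) ℂ) 0 0).im,
        ((V e : Matrix (Fin 2) (Fin 2) ℂ) 0 1).re, ((V e : Matrix (Fin 2) (Fin 2) ℂ) 0 1).im] : Fin 4 → ℝ) j := by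
    intro e j
    have hV : Continuous fun V : GaugeConfig 3 L (Matrix.specialUnitaryGroup (Fin 2) ℂ) => (V e : Matrix (Fin 2) (Fin 2) ℂ) :=
      continuous_subtype_val.comp (continuous_apply e)
    have hent : ∀ a b : Fin 2, Continuous fun V : GaugeConfig 3 L (Matrix.specialUnitaryGroup (Fin 2) ℂ) =>
        (V e : Matrix (Fin 2) (Fin 2) ℂ) a b := fun a b => (continuous_apply b).comp ((continuous_apply a).comp hV)
    fin_cases j
    · exact Complex.continuous_re.comp (hent 0 0)
    · exact Complex.continuous_im.comp (hent 0 0)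
    · exact Complex.continuous_re.comp (hent 0 1)
    · exact Complex.continuous_im.comp (hent 0 1)
  set coordFn : Edge 3 L × Fin 4 → C(GaugeConfig 3 L (Matrix.specialUnitaryGroup (Fin 2) ℂ), ℝ) := fun ej =>
    ⟨fun V => (![((V ej.1 : Matrix (Fin 2) (Fin 2) ℂ) 0 0).re, ((V ej.1 : Matrix (Fin 2) (Fin 2) ℂ) 0 0).im,
        ((V ej.1 : Matrix (Fin 2) (Fin 2) ℂ) 0 1).re, ((V ej.1 : Matrix (Fin 2) (Fin 2) ℂ) 0 1).im] : Fin 4 → ℝ) ej.2,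
      hcont ej.1 ej.2⟩ with hcoordFn
  set A : Subalgebra ℝ C(GaugeConfig 3 L (Matrix.specialUnitaryGroup (Fin 2) ℂ), ℝ) :=
    Algebra.adjoin ℝ (Set.range coordFn) with hA
  -- the coordinate algebra separates points
  have hsep : A.SeparatesPoints := by
    intro V V' hne
    have hex : ∃ e, V e ≠ V' e := by
      by_contra hall
      exact hne (funext fun e => not_not.1 (not_exists.1 hall e))
    obtain ⟨e, he⟩ := hex
    have hcoords : ¬ (((V e : Matrix (Fin 2) (Fin 2) ℂ) 0 0 = (V' e : Matrix (Fin 2) (Fin 2) ℂ) 0 0) ∧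
        ((V e : Matrix (Fin 2) (Fin 2) ℂ) 0 1 = (V' e : Matrix (Fin 2) (Fin 2) ℂ) 0 1)) :=
      fun h => he (Literature.MathematicalPhysics.QuantumFieldTheory.su2_ext h.1 h.2)
    rw [not_and_or] at hcoords
    -- pick the differing real coordinate
    have hexj : ∃ j : Fin 4, coordFn (e, j) V ≠ coordFn (e, j) V' := by
      rcases hcoords with h | h
      · by_cases hre : ((V e : Matrix (Fin 2) (Fin 2) ℂ) 0 0).re = ((V' e : Matrix (Fin 2) (Fin 2) ℂ) 0 0).re
        · refine ⟨1, fun him => h (Complex.ext hre ?_)⟩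
          simpa [hcoordFn] using him
        · exact ⟨0, fun h0 => hre (by simpa [hcoordFn] using h0)⟩
      · by_cases hre : ((V e : Matrix (Fin 2) (Fin 2) ℂ) 0 1).re = ((V' e : Matrix (Fin 2) (Fin 2) ℂ) 0 1).re
        · refine ⟨3, fun him => h (Complex.ext hre ?_)⟩
          simpa [hcoordFn] using him
        · exact ⟨2, fun h0 => hre (by simpa [hcoordFn] using h0)⟩
    obtain ⟨j, hj⟩ := hexj
    refine ⟨coordFn (e, j), ⟨coordFn (e, j), ?_, rfl⟩, hj⟩
    exact Algebra.subset_adjoin ⟨(e, j), rfl⟩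
  -- every element of the coordinate algebra is in ridge form
  have hridge : ∀ F ∈ A, ∃ (κ : Type) (_ : Fintype κ) (c : κ → ℝ)
      (g : κ → Edge 3 L → Matrix.specialUnitaryGroup (Fin 2) ℂ) (m : κ → Edge 3 L → ℕ), ∀ V,
      F V = ∑ l, c l * ∏ e, gegenbauerSum 1 (m l e)
        (hsForm 2 (fundamentalRep (Fin 2) (g l e)) (fundamentalRep (Fin 2) (V e)) / 2) := by
    intro F hF
    rw [hA] at hF
    induction hF using Algebra.adjoin_induction with
    | mem F hF =>
      obtain ⟨⟨e, j⟩, rfl⟩ := hF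
      obtain ⟨κ, hκ, c, g, m, h⟩ := exists_ridge_of_prod_mvPolynomial (L := L)
        (fun e' => if e' = e then MvPolynomial.X j else 1)
      refine ⟨κ, hκ, c, g, m, fun V => ?_⟩
      rw [← h V]
      have hprod : ∀ e' : Edge 3 L, MvPolynomial.eval (![((V e' : Matrix (Fin 2) (Fin 2) ℂ) 0 0).re,
          ((V e' : Matrix (Fin 2) (Fin 2) ℂ) 0 0).im, ((V e' : Matrix (Fin 2) (Fin 2) ℂ) 0 1).re,
          ((V e' : Matrix (Fin 2) (Fin 2) ℂ) 0 1).im] : Fin 4 → ℝ) (if e' = e then MvPolynomial.X j else 1) =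
          if e' = e then coordFn (e, j) V else 1 := by
        intro e'
        by_cases he : e' = e
        · subst he; simp [hcoordFn]
        · simp [he]
      simp_rw [hprod]
      rw [Finset.prod_ite_eq' univ e, if_pos (mem_univ _)]
    | algebraMap r =>
      obtain ⟨κ, hκ, c, g, m, h⟩ := exists_ridge_const (L := L) r
      exact ⟨κ, hκ, c, g, m, fun V => by rw [← h V]; simp [Algebra.algebraMap_eq_smul_one]⟩
    | add F₁ F₂ _ _ h₁ h₂ =>
      obtain ⟨κ, hκ, c, g, m, h⟩ := exists_ridge_add h₁ h₂
      exact ⟨κ, hκ, c, g, m, fun V => by rw [← h V]; rfl⟩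
    | mul F₁ F₂ _ _ h₁ h₂ =>
      obtain ⟨κ, hκ, c, g, m, h⟩ := exists_ridge_mul h₁ h₂
      exact ⟨κ, hκ, c, g, m, fun V => by rw [← h V]; rfl⟩
  -- Stone–Weierstrass
  obtain ⟨⟨F, hFA⟩, hF⟩ := ContinuousMap.exists_mem_subalgebra_near_continuous_of_separatesPoints A hsep G hG ε hε
  obtain ⟨κ, hκ, c, g, m, h⟩ := hridge F hFA
  refine ⟨κ, hκ, c, g, m, fun V => ?_⟩
  rw [← h V]
  have := hF V
  rwa [Real.norm_eq_abs] at this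

end Summit.QuantumFields.YangMills.Theorems.ColdStartUniversality

end
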